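import Summits.AtomisticToContinuum.Crystallization.Theorems.DefectFreeCrystallizes.Negative.PredicateAPI

/-!
# Negative knowledge for crux `DefectFreeCrystallizes` — the fcc-lattice ball as a test configuration
# (standing disprover, gen 3; supports stmt-AtomisticToContinuum-13603)

Small-model facts used by `Negative.SqueezeWindowNeedsMinimality` (and reusable by every line that
quantifies over all-good configurations): the fcc lattice in CUBIC coordinates,
`fccVec v = v/√2` for even-sum integer vectors `v` (nearest-neighbour distance `1`).

* `mem_fccInt_of` — the only even-sum integer vectors of squared norm `≤ 2` are `0` and the twelve
  vectors of `fccInt` (finite check);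
* `fccBall M` — all lattice points with `‖fccVec v‖ ≤ M`, enumerated injectively; `reflect_mem_range_fccBall`
  — fcc is closed under point reflections `2p − q` (it is a lattice);
* `good_fccBall` — every site at depth `≥ 3` of the ball is GOOD for the crux's predicate
  (`Negative.PredicateAPI.Good`) at scale `1` with the identity isometry: its `6/5`-shell IS
  `fccKissingPattern`;
* `exists_fccVec_near` — every point of space is within `6/5` of a lattice point (rounding).

Nothing here closes an item; no theorem concludes a Theses decl.
-/

noncomputable section

namespace Summit.AtomisticToContinuum.Crystallization.Theorems.DefectFreeCrystallizes.Negative.FccBall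

open Literature.MathematicalPhysics.StatisticalMechanics Literature.Geometry.DiscreteGeometry
open Summit.AtomisticToContinuum.Crystallization.Theorems.DefectFreeCrystallizes.Negative

local notation "E3" => EuclideanSpace ℝ (Fin 3)

/-! ### The fcc witness: a ball of the fcc lattice in cubic coordinates -/

/-- The fcc lattice point with (even-sum) integer coordinates `v`; nearest-neighbour distance `1`. -/
def fccVec (v : Fin 3 → ℤ) : E3 := (Real.sqrt (2 : ℕ))⁻¹ • intVec v

/-- `√2 > 0` (with the `ℕ`-cast spelling of `fccKissingPattern`). [folklore] -/
theorem sqrt2_pos : (0 : ℝ) < Real.sqrt (2 : ℕ) := by positivity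

/-- `fccVec` is additive: differences. [folklore] -/
theorem fccVec_sub (v w : Fin 3 → ℤ) : fccVec v - fccVec w = fccVec (v - w) := by
  rw [fccVec, fccVec, ← smul_sub, intVec_sub]; rfl

/-- `fccVec` is additive: sums. [folklore] -/
theorem fccVec_add (v w : Fin 3 → ℤ) : fccVec v + fccVec w = fccVec (v + w) := by
  have := fccVec_sub (v + w) w
  rw [add_sub_cancel_right] at this
  rw [← this, sub_add_cancel]

/-- `‖fccVec v‖² = |v|²/2`. [folklore] -/
theorem norm_fccVec_sq (v : Fin 3 → ℤ) : ‖fccVec v‖ ^ 2 = (sqNormInt v : ℝ) / 2 := by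
  rw [fccVec, norm_smul, norm_inv, Real.norm_of_nonneg sqrt2_pos.le, norm_intVec, mul_pow, inv_pow,
    Real.sq_sqrt (by positivity), Real.sq_sqrt (by exact_mod_cast sqNormInt_nonneg' v)]
  push_cast; ring
where
  /-- auxiliary: `sqNormInt ≥ 0` over `ℤ` -/
  sqNormInt_nonneg' (v : Fin 3 → ℤ) : (0 : ℤ) ≤ sqNormInt v := by unfold sqNormInt; positivity

/-- The integer squared norm is non-negative. [folklore] -/
theorem sqNormInt_nonneg_int (v : Fin 3 → ℤ) : (0 : ℤ) ≤ sqNormInt v := by unfold sqNormInt; positivity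

/-- `fccVec` is injective. [folklore] -/
theorem fccVec_injective : Function.Injective fccVec := by
  intro v w h
  have : intVec v = intVec w := smul_right_injective E3 (inv_ne_zero sqrt2_pos.ne') h
  exact intVec_injective this

/-- `fccVec 0 = 0`. [folklore] -/
theorem fccVec_zero : fccVec 0 = 0 := by
  rw [fccVec]; convert smul_zero _; ext i; simp [intVec]

/-- Members of `fccInt` have even coordinate sum, squared norm `2`, and are non-zero. -/
theorem fccInt_props : ∀ d ∈ fccInt, Even (d 0 + d 1 + d 2) ∧ sqNormInt d = 2 ∧ d ≠ 0 := by decide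

/-- The finite check: an even-sum integer vector with every coordinate in `{-1,0,1}`, squared norm
`≤ 2` and non-zero is one of the twelve fcc vectors. -/
theorem mem_fccInt_of_box : ∀ a ∈ Finset.Icc (-1 : ℤ) 1, ∀ b ∈ Finset.Icc (-1 : ℤ) 1, ∀ c ∈ Finset.Icc (-1 : ℤ) 1,
    Even (a + b + c) → a ^ 2 + b ^ 2 + c ^ 2 ≤ 2 → (a, b, c) ≠ (0, 0, 0) → ![a, b, c] ∈ fccInt := by
  decide

/-- **The only even-sum integer vectors of squared norm `≤ 2` are `0` and the twelve fcc vectors.** -/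
theorem mem_fccInt_of {d : Fin 3 → ℤ} (he : Even (d 0 + d 1 + d 2)) (hn : sqNormInt d ≤ 2) (h0 : d ≠ 0) :
    d ∈ fccInt := by
  have hb : ∀ i, d i ∈ Finset.Icc (-1 : ℤ) 1 := by
    intro i
    have hi : d i ^ 2 ≤ 2 := by
      have : d 0 ^ 2 + d 1 ^ 2 + d 2 ^ 2 ≤ 2 := hn
      fin_cases i <;> simp <;> nlinarith [sq_nonneg (d 0), sq_nonneg (d 1), sq_nonneg (d 2)]
    have h1 : -2 < d i ∧ d i < 2 := by constructor <;> nlinarith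
    rw [Finset.mem_Icc]; constructor <;> omega
  have hd : d = ![d 0, d 1, d 2] := by ext i; fin_cases i <;> rfl
  rw [hd]
  refine mem_fccInt_of_box _ (hb 0) _ (hb 1) _ (hb 2) he hn ?_
  intro h
  apply h0
  simp only [Prod.mk.injEq] at h
  rw [hd]; ext i; fin_cases i <;> simp [h.1, h.2.1, h.2.2]

/-- Index set of the witness: even-sum integer vectors of squared norm `≤ 2 M²` (i.e. `‖fccVec v‖ ≤ M`). -/
def fccBallIdx (M : ℕ) : Finset (Fin 3 → ℤ) :=
  (Fintype.piFinset fun _ : Fin 3 => Finset.Icc (-(2 * M : ℤ)) (2 * M)).filter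
    fun v => Even (v 0 + v 1 + v 2) ∧ sqNormInt v ≤ 2 * (M : ℤ) ^ 2

/-- Membership in the index set is the parity + norm condition (the box is automatic). [folklore] -/
theorem mem_fccBallIdx {M : ℕ} {v : Fin 3 → ℤ} :
    v ∈ fccBallIdx M ↔ Even (v 0 + v 1 + v 2) ∧ sqNormInt v ≤ 2 * (M : ℤ) ^ 2 := by
  rw [fccBallIdx, Finset.mem_filter, Fintype.mem_piFinset]
  constructor
  · exact fun h => h.2
  · intro h
    refine ⟨fun i => ?_, h⟩
    have hi : v i ^ 2 ≤ 2 * (M : ℤ) ^ 2 := by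
      have : v 0 ^ 2 + v 1 ^ 2 + v 2 ^ 2 ≤ 2 * (M : ℤ) ^ 2 := h.2
      fin_cases i <;> simp <;> nlinarith [sq_nonneg (v 0), sq_nonneg (v 1), sq_nonneg (v 2)]
    have h2 : |v i| ≤ 2 * (M : ℤ) := by
      have hM : (0 : ℤ) ≤ 2 * M := by positivity
      exact abs_le_of_sq_le_sq' (by nlinarith) hM |> fun h => abs_le.2 h
    rw [Finset.mem_Icc]; constructor <;> [linarith [neg_abs_le (v i)]; linarith [le_abs_self (v i)]]

/-- The origin is in the ball. [folklore] -/
theorem zero_mem_fccBallIdx (M : ℕ) : (0 : Fin 3 → ℤ) ∈ fccBallIdx M := by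
  rw [mem_fccBallIdx]; simp [sqNormInt]

/-- Norm criterion for membership. -/
theorem mem_fccBallIdx_of_norm {M : ℕ} {v : Fin 3 → ℤ} (he : Even (v 0 + v 1 + v 2)) (hn : ‖fccVec v‖ ≤ M) :
    v ∈ fccBallIdx M := by
  rw [mem_fccBallIdx]
  refine ⟨he, ?_⟩
  have h1 : ‖fccVec v‖ ^ 2 ≤ (M : ℝ) ^ 2 := pow_le_pow_left₀ (norm_nonneg _) hn 2
  rw [norm_fccVec_sq] at h1
  have : (sqNormInt v : ℝ) ≤ 2 * (M : ℝ) ^ 2 := by linarith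
  exact_mod_cast this

/-- Points of the index set have `‖fccVec v‖ ≤ M`. [folklore] -/
theorem norm_le_of_mem_fccBallIdx {M : ℕ} {v : Fin 3 → ℤ} (hv : v ∈ fccBallIdx M) : ‖fccVec v‖ ≤ M := by
  rw [mem_fccBallIdx] at hv
  have h1 : ‖fccVec v‖ ^ 2 ≤ (M : ℝ) ^ 2 := by
    rw [norm_fccVec_sq]
    have : (sqNormInt v : ℝ) ≤ 2 * (M : ℝ) ^ 2 := by exact_mod_cast hv.2
    linarith
  exact (pow_le_pow_iff_left₀ (norm_nonneg _) (by positivity) two_ne_zero).1 h1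

/-- **The witness configuration**: all fcc lattice points within distance `M` of the origin, enumerated. -/
def fccBall (M : ℕ) : Fin (fccBallIdx M).card → E3 := fun n => fccVec ((fccBallIdx M).equivFin.symm n)

/-- The enumeration is injective (distinct particles). [folklore] -/
theorem fccBall_injective (M : ℕ) : Function.Injective (fccBall M) := by
  intro n m h
  have h1 := fccVec_injective h
  exact (fccBallIdx M).equivFin.symm.injective (Subtype.ext h1)

/-- Unfolding the enumeration. [folklore] -/
theorem fccBall_apply (M : ℕ) (n : Fin (fccBallIdx M).card) :
    fccBall M n = fccVec ((fccBallIdx M).equivFin.symm n) := rfl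

/-- The particle indexed by `v` sits at `fccVec v`. [folklore] -/
theorem fccBall_equivFin (M : ℕ) (v : Fin 3 → ℤ) (hv : v ∈ fccBallIdx M) :
    fccBall M ((fccBallIdx M).equivFin ⟨v, hv⟩) = fccVec v := by
  rw [fccBall_apply, Equiv.symm_apply_apply]

/-- The range of the enumeration is the lattice ball. [folklore] -/
theorem mem_range_fccBall {M : ℕ} {p : E3} : p ∈ Set.range (fccBall M) ↔ ∃ v ∈ fccBallIdx M, p = fccVec v := by
  constructor
  · rintro ⟨n, rfl⟩
    exact ⟨_, ((fccBallIdx M).equivFin.symm n).2, rfl⟩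
  · rintro ⟨v, hv, rfl⟩
    exact ⟨(fccBallIdx M).equivFin ⟨v, hv⟩, fccBall_equivFin M v hv⟩

/-- fcc is a lattice: closed under point reflections `2p − q`. -/
theorem reflect_mem_range_fccBall {M : ℕ} {p q : E3} (hp : p ∈ Set.range (fccBall M))
    (hq : q ∈ Set.range (fccBall M)) (hn : ‖(2 : ℝ) • p - q‖ ≤ M) : (2 : ℝ) • p - q ∈ Set.range (fccBall M) := by
  rw [mem_range_fccBall] at hp hq ⊢
  obtain ⟨v, hv, rfl⟩ := hp
  obtain ⟨w, hw, rfl⟩ := hq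
  have hvw : (2 : ℝ) • fccVec v - fccVec w = fccVec (v + v - w) := by
    rw [two_smul, fccVec_add, fccVec_sub]
  refine ⟨v + v - w, mem_fccBallIdx_of_norm ?_ (hvw ▸ hn), hvw⟩
  have h1 := (mem_fccBallIdx.1 hv).1
  have h2 := (mem_fccBallIdx.1 hw).1
  simp only [Pi.sub_apply, Pi.add_apply]
  have : v 0 + v 0 - w 0 + (v 1 + v 1 - w 1) + (v 2 + v 2 - w 2) = (v 0 + v 1 + v 2) + (v 0 + v 1 + v 2) - (w 0 + w 1 + w 2) := by ring
  rw [this]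
  exact Even.sub (h1.add h1) h2

/-- **Interior sites of the fcc ball are good** (scale `1`, identity isometry: the `6/5`-shell IS the
fcc kissing pattern). -/
theorem good_fccBall {M : ℕ} (n : Fin (fccBallIdx M).card) (hn : ‖fccBall M n‖ + 3 ≤ M) :
    PredicateAPI.Good (fccBall M) n := by
  set v : Fin 3 → ℤ := ((fccBallIdx M).equivFin.symm n : Fin 3 → ℤ) with hvdef
  have hv : v ∈ fccBallIdx M := ((fccBallIdx M).equivFin.symm n).2
  have hxn : fccBall M n = fccVec v := rfl
  have hshell : PredicateAPI.shell (fccBall M) n 1 = fccKissingPattern := by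
    ext q
    simp only [PredicateAPI.shell, PredicateAPI.nbrs, Finset.mem_image, Finset.mem_filter, Finset.mem_univ,
      true_and, inv_one, one_smul]
    constructor
    · rintro ⟨m, ⟨hmn, hdist⟩, rfl⟩
      set w : Fin 3 → ℤ := ((fccBallIdx M).equivFin.symm m : Fin 3 → ℤ) with hwdef
      have hw : w ∈ fccBallIdx M := ((fccBallIdx M).equivFin.symm m).2
      have hxm : fccBall M m = fccVec w := rfl
      rw [hxm, hxn, fccVec_sub]
      have hd0 : w - v ≠ 0 := by
        intro h0
        apply hmn
        have : w = v := sub_eq_zero.1 h0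
        have : (fccBallIdx M).equivFin.symm m = (fccBallIdx M).equivFin.symm n := Subtype.ext this
        exact (fccBallIdx M).equivFin.symm.injective this
      have he : Even ((w - v) 0 + (w - v) 1 + (w - v) 2) := by
        have h1 := (mem_fccBallIdx.1 hv).1
        have h2 := (mem_fccBallIdx.1 hw).1
        simp only [Pi.sub_apply]
        have : w 0 - v 0 + (w 1 - v 1) + (w 2 - v 2) = (w 0 + w 1 + w 2) - (v 0 + v 1 + v 2) := by ring
        rw [this]; exact h2.sub h1
      have hsq : sqNormInt (w - v) ≤ 2 := by
        rw [hxn, hxm, dist_comm, dist_eq_norm, fccVec_sub] at hdist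
        have h1 : ‖fccVec (w - v)‖ ^ 2 ≤ (6 / 5) ^ 2 := pow_le_pow_left₀ (norm_nonneg _) hdist 2
        rw [norm_fccVec_sq] at h1
        have h2 : (sqNormInt (w - v) : ℝ) < 3 := by linarith
        have h3 : sqNormInt (w - v) < 3 := by exact_mod_cast h2
        omega
      have hmem := mem_fccInt_of he hsq hd0
      rw [fccKissingPattern]
      exact Finset.mem_image_of_mem _ hmem
    · intro hq
      rw [fccKissingPattern, scaledPattern, Finset.mem_image] at hq
      obtain ⟨d, hd, rfl⟩ := hq
      obtain ⟨hde, hdn, hd0⟩ := fccInt_props d hd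
      have hw : v + d ∈ fccBallIdx M := by
        refine mem_fccBallIdx_of_norm ?_ ?_
        · have h1 := (mem_fccBallIdx.1 hv).1
          simp only [Pi.add_apply]
          have : v 0 + d 0 + (v 1 + d 1) + (v 2 + d 2) = (v 0 + v 1 + v 2) + (d 0 + d 1 + d 2) := by ring
          rw [this]; exact h1.add hde
        · rw [← fccVec_add]
          have hnd : ‖fccVec d‖ = 1 := by
            have hnd2 : ‖fccVec d‖ ^ 2 = 1 := by rw [norm_fccVec_sq d, hdn]; norm_num
            rw [← Real.sqrt_sq (norm_nonneg (fccVec d)), hnd2, Real.sqrt_one]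
          calc ‖fccVec v + fccVec d‖ ≤ ‖fccVec v‖ + ‖fccVec d‖ := norm_add_le _ _
            _ ≤ M := by rw [hnd, ← hxn]; linarith
      refine ⟨(fccBallIdx M).equivFin ⟨v + d, hw⟩, ⟨?_, ?_⟩, ?_⟩
      · intro h
        have h1 := congrArg (fccBall M) h
        rw [fccBall_equivFin, hxn] at h1
        have h2 := fccVec_injective h1
        exact hd0 (by simpa using h2)
      · rw [fccBall_equivFin, hxn, dist_eq_norm, fccVec_sub]
        have : v - (v + d) = -d := by abel
        rw [this]
        have hnd : ‖fccVec (-d)‖ ^ 2 = 1 := by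
          rw [norm_fccVec_sq]
          have : sqNormInt (-d) = sqNormInt d := by simp [sqNormInt]
          rw [this, hdn]; norm_num
        nlinarith [norm_nonneg (fccVec (-d))]
      · rw [fccBall_equivFin, hxn, fccVec_sub, add_sub_cancel_left]
        rfl
  refine ⟨1, by norm_num, by norm_num, Or.inl ?_⟩
  rw [hshell]
  exact ShellCloseTo.refl (by norm_num) _

/-! ### Rounding to the fcc lattice -/

/-- `(√2)² = 2` (with the `ℕ`-cast spelling). [folklore] -/
theorem sqrt2n_sq : Real.sqrt (2 : ℕ) ^ 2 = 2 := by push_cast; exact Real.sq_sqrt (by norm_num)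

/-- Coordinates of `fccVec`. [folklore] -/
theorem fccVec_apply (v : Fin 3 → ℤ) (i : Fin 3) : fccVec v i = (Real.sqrt (2 : ℕ))⁻¹ * v i := by
  simp [fccVec, intVec]

/-- Every point of space is within `6/5` of an fcc lattice point (round the cubic coordinates, fix
the parity with the last one; error² ≤ (1/4 + 1/4 + 9/4)/2 = 11/8). -/
theorem exists_fccVec_near (c : E3) : ∃ v : Fin 3 → ℤ, Even (v 0 + v 1 + v 2) ∧ ‖fccVec v - c‖ ≤ 6 / 5 := by
  set a : ℤ := round (Real.sqrt (2 : ℕ) * c 0)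
  set b : ℤ := round (Real.sqrt (2 : ℕ) * c 1)
  set k : ℤ := round (Real.sqrt (2 : ℕ) * c 2)
  have ha : |Real.sqrt (2 : ℕ) * c 0 - a| ≤ 1 / 2 := abs_sub_round _
  have hb : |Real.sqrt (2 : ℕ) * c 1 - b| ≤ 1 / 2 := abs_sub_round _
  have hk : |Real.sqrt (2 : ℕ) * c 2 - k| ≤ 1 / 2 := abs_sub_round _
  -- the third coordinate, parity-corrected
  obtain ⟨k', hpar, hk'⟩ : ∃ k' : ℤ, Even (a + b + k') ∧ |Real.sqrt (2 : ℕ) * c 2 - k'| ≤ 3 / 2 := by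
    by_cases he : Even (a + b + k)
    · exact ⟨k, he, hk.trans (by norm_num)⟩
    · refine ⟨k + 1, ?_, ?_⟩
      · have : a + b + (k + 1) = (a + b + k) + 1 := by ring
        rw [this]; exact (Int.not_even_iff_odd.1 he).add_one
      · rw [abs_le] at hk ⊢; push_cast; constructor <;> linarith [hk.1, hk.2]
  refine ⟨![a, b, k'], by simpa using hpar, ?_⟩
  have hs : (0 : ℝ) < Real.sqrt (2 : ℕ) := sqrt2_pos
  have h2 := sqrt2n_sq
  have hsq : ‖fccVec ![a, b, k'] - c‖ ^ 2 ≤ (6 / 5) ^ 2 := by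
    rw [EuclideanSpace.norm_eq, Real.sq_sqrt (by positivity), Fin.sum_univ_three]
    simp only [PiLp.sub_apply, fccVec_apply, Real.norm_eq_abs, sq_abs]
    have e : ∀ (z : ℤ) (x : ℝ), ((Real.sqrt (2 : ℕ))⁻¹ * (z : ℝ) - x) ^ 2 = (Real.sqrt (2 : ℕ) * x - z) ^ 2 / 2 := by
      intro z x
      field_simp
      rw [h2]; ring
    simp only [Matrix.cons_val_zero, Matrix.cons_val_one, Matrix.head_cons, Matrix.cons_val_two, Matrix.tail_cons]
    rw [e, e, e]
    rw [abs_le] at ha hb hk'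
    nlinarith [ha.1, ha.2, hb.1, hb.2, hk'.1, hk'.2]
  exact (pow_le_pow_iff_left₀ (norm_nonneg _) (by norm_num) two_ne_zero).1 hsq


end Summit.AtomisticToContinuum.Crystallization.Theorems.DefectFreeCrystallizes.Negative.FccBall

end
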